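import Mathlib
import HarnessLib

/-!
# The finite-sample Jarzynski free-energy estimator: its bias is non-negative, decreases with the sample size, and is lowered by the delete-one jackknife

HONEST FRAMING: exact (Metropolis-corrected) sampling algorithms for lattice gauge theory;
figures of merit are autocorrelation/cost numbers at stated couplings and volumes; no
continuum-physics claim.

Venture `LatticeQCDFlow` (cell pub-lqcd), topic `Exactness`; FANOUT row 13 (`eng-snf`: the
`latflow-snf` protocol engine — `snf.estimators.free_energy` reports `dF = −log mean e^{−W}` AND the
delete-one-block jackknife `dF_biascorr`).  NEW WORK of the cell (elementary: Jensen's inequality for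
`log` on finite product laws and the leave-one-out identity for sample means); the printed observation
that the estimator's systematic error is positive and falls with `N` (D. M. Zuckerman, T. B. Woolf,
Phys. Rev. Lett. 89 (2002) 180602; J. Gore, F. Ritort, C. Bustamante, PNAS 100 (2003) 12564) is named
only, nothing is cited as a fact.

## Content

A finite set `Y` of outcomes with a probability law `p` (`0 ≤ p`, `Σ p = 1`) and positive weights
`w : Y → ℝ` (think `w = e^{−W}` for one non-equilibrium evolution, so that `E_p[w] = e^{−ΔF}` by
Jarzynski).  `N` i.i.d. evolutions have the product law `productLaw p y = Π_i p (y i)` on `Fin N → Y`;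
the estimator is `jarzynskiEstimate w y = −log ((1/N) Σ_i w (y i))` and its expectation is
`estimatorMean p w N = Σ_y productLaw p y · jarzynskiEstimate w y`.
* `sum_productLaw` / `sum_productLaw_mul_removeNth` / `sum_productLaw_mul_coord` — the product law
  has mass one; integrating out one coordinate of a function of the other `N` coordinates leaves the
  `N`-sample expectation; a function of one coordinate integrates to its `p`-expectation
  (marginalisation through `Fin.insertNthEquiv`).
* `expectation_sampleMean` — `E[(1/N) Σ_i w(y i)] = E_p[w]` (`N ≥ 1`).
* `estimatorMean_ge` — **non-negative bias**: `−log E_p[w] ≤ estimatorMean p w N` for every `N ≥ 1`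
  (Jensen, `log` concave): the finite-`N` Jarzynski estimate over-estimates `ΔF` on average.
* `sampleMean_eq_avg_leaveOneOut` — the leave-one-out identity
  `(1/(N+1)) Σ_k w(y k) = (1/(N+1)) Σ_j [(1/N) Σ_{i} w(y (j.succAbove i))]`.
* `estimatorMean_succ_le` / `estimatorMean_antitone` — **the bias decreases with N**:
  `estimatorMean p w (N+1) ≤ estimatorMean p w N` (`N ≥ 1`), hence `estimatorMean p w M ≤ estimatorMean p w N`
  for `1 ≤ N ≤ M`: concavity of `log` on the leave-one-out average, then marginalisation.
* `jackknifeMean_le` — the delete-one JACKKNIFE expectation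
  `(N+1)·estimatorMean (N+1) − N·estimatorMean N` is `≤ estimatorMean (N+1)`: the correction
  `snf.estimators.free_energy` applies moves the expectation DOWN, i.e. against the sign of the bias
  (it may over-correct; nothing here bounds it below by `−log E_p[w]`).
Scope: i.i.d. evolutions (iid-exact priors, or replica starts treated as independent); for correlated
chain starts the engine's BLOCK jackknife is the analogue and is not covered here.
-/

namespace Summit.Ventures.LatticeQCDFlow.Exactness

open Finset

variable {Y : Type*} [Fintype Y]

/-! ## Product laws, sample means, the estimator -/

/-- The law of `N` i.i.d. draws from `p`: `Π_i p (y i)`. -/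
noncomputable def productLaw (p : Y → ℝ) {N : ℕ} (y : Fin N → Y) : ℝ := ∏ i, p (y i)

/-- The sample mean `(1/N) Σ_i w (y i)` of the weights along an `N`-sample. -/
noncomputable def sampleMean (w : Y → ℝ) {N : ℕ} (y : Fin N → Y) : ℝ := (∑ i, w (y i)) / N

/-- The finite-sample Jarzynski free-energy estimate `−log ((1/N) Σ_i w (y i))` (`w = e^{−W}`). -/
noncomputable def jarzynskiEstimate (w : Y → ℝ) {N : ℕ} (y : Fin N → Y) : ℝ := -Real.log (sampleMean w y)

/-- The expectation of the estimate over `N` i.i.d. evolutions. -/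
noncomputable def estimatorMean (p w : Y → ℝ) (N : ℕ) : ℝ :=
  ∑ y : Fin N → Y, productLaw p y * jarzynskiEstimate w y

omit [Fintype Y] in
/-- The product law is non-negative. -/
theorem productLaw_nonneg {p : Y → ℝ} (hp : ∀ a, 0 ≤ p a) {N : ℕ} (y : Fin N → Y) : 0 ≤ productLaw p y :=
  prod_nonneg fun i _ => hp (y i)

/-- The product law has total mass one. -/
theorem sum_productLaw (p : Y → ℝ) (hp1 : ∑ a, p a = 1) (N : ℕ) : ∑ y : Fin N → Y, productLaw p y = 1 := by
  classical
  unfold productLaw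
  have h := (Finset.prod_univ_sum (fun _ : Fin N => (univ : Finset Y)) (fun _ a => p a)).symm
  rw [Fintype.piFinset_univ] at h
  rw [h, prod_const, hp1, one_pow]

omit [Fintype Y] in
/-- Sample means of positive weights are positive (`N ≥ 1`). -/
theorem sampleMean_pos {w : Y → ℝ} (hw : ∀ a, 0 < w a) {N : ℕ} (hN : 0 < N) (y : Fin N → Y) :
    0 < sampleMean w y := by
  unfold sampleMean
  haveI : Nonempty (Fin N) := ⟨⟨0, hN⟩⟩
  exact div_pos (sum_pos (fun i _ => hw (y i)) univ_nonempty) (by exact_mod_cast hN)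

/-- **Marginalisation.**  Integrating a function of the coordinates other than `j` against the
`(N+1)`-sample law gives its `N`-sample expectation. -/
theorem sum_productLaw_mul_removeNth (p : Y → ℝ) (hp1 : ∑ a, p a = 1) {N : ℕ} (j : Fin (N + 1))
    (F : (Fin N → Y) → ℝ) :
    ∑ y : Fin (N + 1) → Y, productLaw p y * F (j.removeNth y) = ∑ z : Fin N → Y, productLaw p z * F z := by
  rw [← (Fin.insertNthEquiv (fun _ => Y) j).sum_comp]
  have hkey : ∀ x : Y × (Fin N → Y),
      productLaw p ((Fin.insertNthEquiv (fun _ => Y) j) x) * F (j.removeNth ((Fin.insertNthEquiv (fun _ => Y) j) x))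
        = p x.1 * (productLaw p x.2 * F x.2) := by
    intro x
    have h1 : (Fin.insertNthEquiv (fun _ => Y) j) x = Fin.insertNth j x.1 x.2 := rfl
    have h2 : j.removeNth (Fin.insertNth (α := fun _ => Y) j x.1 x.2) = x.2 := by simp
    rw [h1, h2]
    unfold productLaw
    rw [Fin.prod_univ_succAbove _ j, Fin.insertNth_apply_same]
    simp only [Fin.insertNth_apply_succAbove]
    ring
  simp_rw [hkey]
  rw [Fintype.sum_prod_type]
  simp_rw [← mul_sum]
  rw [← sum_mul, hp1, one_mul]

/-- Marginalisation of one coordinate: `E[g (y k)] = E_p[g]` under the product law. -/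
theorem sum_productLaw_mul_coord (p : Y → ℝ) (hp1 : ∑ a, p a = 1) {N : ℕ} (k : Fin (N + 1)) (g : Y → ℝ) :
    ∑ y : Fin (N + 1) → Y, productLaw p y * g (y k) = ∑ a, p a * g a := by
  rw [← (Fin.insertNthEquiv (fun _ => Y) k).sum_comp]
  have hkey : ∀ x : Y × (Fin N → Y),
      productLaw p ((Fin.insertNthEquiv (fun _ => Y) k) x) * g (((Fin.insertNthEquiv (fun _ => Y) k) x) k)
        = (p x.1 * g x.1) * productLaw p x.2 := by
    intro x
    have e1 : (Fin.insertNthEquiv (fun _ => Y) k) x = Fin.insertNth k x.1 x.2 := rfl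
    rw [e1]
    unfold productLaw
    rw [Fin.prod_univ_succAbove _ k, Fin.insertNth_apply_same]
    simp only [Fin.insertNth_apply_succAbove]
    ring
  simp_rw [hkey]
  rw [Fintype.sum_prod_type]
  simp_rw [← mul_sum, sum_productLaw p hp1 N, mul_one]

/-- `E[(1/N) Σ_i w (y i)] = E_p[w]` for `N ≥ 1` i.i.d. draws. -/
theorem expectation_sampleMean (p w : Y → ℝ) (hp1 : ∑ a, p a = 1) :
    ∀ {N : ℕ}, 0 < N → ∑ y : Fin N → Y, productLaw p y * sampleMean w y = ∑ a, p a * w a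
  | 0, h => absurd h (lt_irrefl 0)
  | N + 1, _ => by
    have hcoord : ∀ k : Fin (N + 1), ∑ y : Fin (N + 1) → Y, productLaw p y * w (y k) = ∑ a, p a * w a :=
      fun k => sum_productLaw_mul_coord p hp1 k w
    have hN : ((N + 1 : ℕ) : ℝ) ≠ 0 := by exact_mod_cast Nat.succ_ne_zero N
    calc ∑ y : Fin (N + 1) → Y, productLaw p y * sampleMean w y
        = ∑ y : Fin (N + 1) → Y, ∑ k, productLaw p y * w (y k) / (N + 1 : ℕ) := by
          refine sum_congr rfl fun y _ => ?_
          unfold sampleMean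
          rw [sum_div, mul_sum]
          exact sum_congr rfl fun k _ => by ring
      _ = ∑ k : Fin (N + 1), (∑ y : Fin (N + 1) → Y, productLaw p y * w (y k)) / (N + 1 : ℕ) := by
          rw [sum_comm]; exact sum_congr rfl fun k _ => by rw [sum_div]
      _ = ∑ a, p a * w a := by
          simp_rw [hcoord]
          rw [sum_const, card_univ, Fintype.card_fin, nsmul_eq_mul]
          field_simp

/-! ## Non-negative bias (Jensen) -/

/-- **The finite-sample Jarzynski estimator over-estimates on average.**  For `N ≥ 1` i.i.d.
evolutions with positive weights, `−log E_p[w] ≤ E[−log ((1/N) Σ_i w_i)]`. -/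
theorem estimatorMean_ge (p w : Y → ℝ) (hp : ∀ a, 0 ≤ p a) (hp1 : ∑ a, p a = 1) (hw : ∀ a, 0 < w a)
    {N : ℕ} (hN : 0 < N) :
    -Real.log (∑ a, p a * w a) ≤ estimatorMean p w N := by
  unfold estimatorMean jarzynskiEstimate
  -- Jensen for the concave log: Σ P·log m ≤ log (Σ P·m)
  have hj := (strictConcaveOn_log_Ioi.concaveOn).le_map_sum (t := (univ : Finset (Fin N → Y)))
    (w := fun y => productLaw p y) (p := fun y => sampleMean w y)
    (fun y _ => productLaw_nonneg hp y) (sum_productLaw p hp1 N) (fun y _ => sampleMean_pos hw hN y)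
  simp only [smul_eq_mul] at hj
  rw [expectation_sampleMean p w hp1 hN] at hj
  have : ∑ y : Fin N → Y, productLaw p y * -Real.log (sampleMean w y) =
      -∑ y : Fin N → Y, productLaw p y * Real.log (sampleMean w y) := by
    rw [← sum_neg_distrib]; exact sum_congr rfl fun y _ => by ring
  rw [this]
  linarith

/-! ## The bias decreases with the sample size -/

omit [Fintype Y] in
/-- **Leave-one-out identity.**  The `(N+1)`-sample mean is the average of the `N+1` leave-one-out
`N`-sample means (`N ≥ 1`). -/
theorem sampleMean_eq_avg_leaveOneOut (w : Y → ℝ) {N : ℕ} (hN : 0 < N) (y : Fin (N + 1) → Y) :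
    sampleMean w y = (∑ j : Fin (N + 1), sampleMean w (j.removeNth y)) / (N + 1 : ℕ) := by
  unfold sampleMean
  have hN0 : (N : ℝ) ≠ 0 := by exact_mod_cast hN.ne'
  have hN1 : ((N + 1 : ℕ) : ℝ) ≠ 0 := by exact_mod_cast Nat.succ_ne_zero N
  set S := ∑ k, w (y k) with hS
  have hloo : ∀ j : Fin (N + 1), ∑ i : Fin N, w (j.removeNth y i) = S - w (y j) := by
    intro j
    rw [hS, Fin.sum_univ_succAbove _ j]
    simp only [Fin.removeNth_apply]
    ring
  simp_rw [hloo]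
  rw [← sum_div, sum_sub_distrib, sum_const, card_univ, Fintype.card_fin, nsmul_eq_mul, ← hS]
  push_cast
  field_simp
  ring

/-- **Monotonicity of the bias.**  For `N ≥ 1`, `E[ΔF̂_{N+1}] ≤ E[ΔF̂_N]`: one more evolution can
only lower the expected estimate (towards `−log E_p[w]`, cf. `estimatorMean_ge`). -/
theorem estimatorMean_succ_le (p w : Y → ℝ) (hp : ∀ a, 0 ≤ p a) (hp1 : ∑ a, p a = 1) (hw : ∀ a, 0 < w a)
    {N : ℕ} (hN : 0 < N) :
    estimatorMean p w (N + 1) ≤ estimatorMean p w N := by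
  have hN1 : (0 : ℝ) < (N + 1 : ℕ) := by exact_mod_cast Nat.succ_pos N
  -- pointwise: -log mean_{N+1}(y) ≤ (1/(N+1)) Σ_j -log mean_N(removeNth j y)
  have hpt : ∀ y : Fin (N + 1) → Y, jarzynskiEstimate w y ≤
      (∑ j : Fin (N + 1), jarzynskiEstimate w (j.removeNth y)) / (N + 1 : ℕ) := by
    intro y
    unfold jarzynskiEstimate
    have hj := (strictConcaveOn_log_Ioi.concaveOn).le_map_sum (t := (univ : Finset (Fin (N + 1))))
      (w := fun _ => ((N + 1 : ℕ) : ℝ)⁻¹) (p := fun j => sampleMean w (j.removeNth y))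
      (fun _ _ => by positivity)
      (by rw [sum_const, card_univ, Fintype.card_fin, nsmul_eq_mul]; field_simp)
      (fun j _ => sampleMean_pos hw hN _)
    simp only [smul_eq_mul] at hj
    -- the argument of log on the right is the (N+1)-sample mean (leave-one-out identity)
    have hsum : ∑ j : Fin (N + 1), ((N + 1 : ℕ) : ℝ)⁻¹ * sampleMean w (j.removeNth y) = sampleMean w y := by
      rw [← mul_sum, inv_mul_eq_div, ← sampleMean_eq_avg_leaveOneOut w hN y]
    rw [hsum, ← mul_sum, inv_mul_eq_div] at hj
    rw [sum_neg_distrib, neg_div]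
    exact neg_le_neg hj
  -- integrate against the (N+1)-sample law and marginalise each leave-one-out term
  calc estimatorMean p w (N + 1)
      = ∑ y : Fin (N + 1) → Y, productLaw p y * jarzynskiEstimate w y := rfl
    _ ≤ ∑ y : Fin (N + 1) → Y, productLaw p y *
          ((∑ j : Fin (N + 1), jarzynskiEstimate w (j.removeNth y)) / (N + 1 : ℕ)) :=
        sum_le_sum fun y _ => mul_le_mul_of_nonneg_left (hpt y) (productLaw_nonneg hp y)
    _ = (∑ j : Fin (N + 1), ∑ y : Fin (N + 1) → Y, productLaw p y * jarzynskiEstimate w (j.removeNth y)) /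
          (N + 1 : ℕ) := by
        rw [sum_comm, sum_div]
        refine sum_congr rfl fun y _ => ?_
        rw [← mul_div_assoc, mul_sum]
    _ = (∑ _j : Fin (N + 1), estimatorMean p w N) / (N + 1 : ℕ) := by
        congr 1
        exact sum_congr rfl fun j _ => sum_productLaw_mul_removeNth p hp1 j (jarzynskiEstimate w)
    _ = estimatorMean p w N := by
        rw [sum_const, card_univ, Fintype.card_fin, nsmul_eq_mul]
        field_simp

/-- **The bias is monotone over any number of extra evolutions**: `E[ΔF̂_M] ≤ E[ΔF̂_N]` for `1 ≤ N ≤ M`. -/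
theorem estimatorMean_antitone (p w : Y → ℝ) (hp : ∀ a, 0 ≤ p a) (hp1 : ∑ a, p a = 1) (hw : ∀ a, 0 < w a)
    {N M : ℕ} (hN : 0 < N) (hNM : N ≤ M) :
    estimatorMean p w M ≤ estimatorMean p w N := by
  induction M, hNM using Nat.le_induction with
  | base => exact le_rfl
  | succ M hNM ih => exact (estimatorMean_succ_le p w hp hp1 hw (lt_of_lt_of_le hN hNM)).trans ih

/-! ## The delete-one jackknife lowers the expectation -/

/-- **Jackknife.**  The delete-one jackknife bias-corrected estimate from `N+1` evolutions,
`(N+1)·ΔF̂_{N+1} − N·(1/(N+1)) Σ_j ΔF̂_N^{(−j)}`, has expectation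
`(N+1)·E[ΔF̂_{N+1}] − N·E[ΔF̂_N] ≤ E[ΔF̂_{N+1}]` (`N ≥ 1`): the correction acts against the
(non-negative, `estimatorMean_ge`) bias. -/
theorem jackknifeMean_le (p w : Y → ℝ) (hp : ∀ a, 0 ≤ p a) (hp1 : ∑ a, p a = 1) (hw : ∀ a, 0 < w a)
    {N : ℕ} (hN : 0 < N) :
    ((N + 1 : ℕ) : ℝ) * estimatorMean p w (N + 1) - (N : ℝ) * estimatorMean p w N ≤ estimatorMean p w (N + 1) := by
  have h := estimatorMean_succ_le p w hp hp1 hw hN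
  have hNr : (0 : ℝ) < N := by exact_mod_cast hN
  push_cast
  nlinarith

/-- The expectation of the jackknife estimator written as an average over the data: for every
`(N+1)`-sample law, `E[(1/(N+1)) Σ_j ΔF̂_N(removeNth j ·)] = E[ΔF̂_N]`, so the jackknife's expectation is
exactly `(N+1)·estimatorMean (N+1) − N·estimatorMean N` as used in `jackknifeMean_le`. -/
theorem expectation_leaveOneOut_avg (p w : Y → ℝ) (hp1 : ∑ a, p a = 1) (N : ℕ) :
    ∑ y : Fin (N + 1) → Y, productLaw p y *
        ((∑ j : Fin (N + 1), jarzynskiEstimate w (j.removeNth y)) / (N + 1 : ℕ)) = estimatorMean p w N := by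
  have hN1 : ((N + 1 : ℕ) : ℝ) ≠ 0 := by exact_mod_cast Nat.succ_ne_zero N
  calc ∑ y : Fin (N + 1) → Y, productLaw p y *
          ((∑ j : Fin (N + 1), jarzynskiEstimate w (j.removeNth y)) / (N + 1 : ℕ))
      = (∑ j : Fin (N + 1), ∑ y : Fin (N + 1) → Y, productLaw p y * jarzynskiEstimate w (j.removeNth y)) /
          (N + 1 : ℕ) := by
        rw [sum_comm, sum_div]
        refine sum_congr rfl fun y _ => ?_
        rw [← mul_div_assoc, mul_sum]
    _ = (∑ _j : Fin (N + 1), estimatorMean p w N) / (N + 1 : ℕ) := by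
        congr 1
        exact sum_congr rfl fun j _ => sum_productLaw_mul_removeNth p hp1 j (jarzynskiEstimate w)
    _ = estimatorMean p w N := by
        rw [sum_const, card_univ, Fintype.card_fin, nsmul_eq_mul]
        field_simp

end Summit.Ventures.LatticeQCDFlow.Exactness
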